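import Literature.Probability.RandomPlanarGeometry.PlanarDomainsTopology
import Literature.Probability.RandomPlanarGeometry.JordanBoundaryLemmas
import HarnessLib

/-!
# Corners of a marked Jordan domain: intersections of arcs and the corner modulus

Topic: Probability / RandomPlanarGeometry. Elementary metric facts about the arcs `Aᵢ = arc i`
and the marked points ("corners") `Pᵢ = pt i` of a marked Jordan domain, used to read off which
arc a boundary point is close to (Bollobás–Riordan, *Percolation* (2006), Ch. 7 p. 191: "the
closest boundary arc … can only switch when we are very close to some `P_k`"):

* `mem_arc_inter_arc` — two distinct arcs meet only in marked points (endpoints of the first);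
  `pt_mem_arc_iff` — `P_m ∈ A_i ↔ m = i ∨ m = i + 1`;
* `exists_corner_modulus` — **corner modulus**: for every `ρ > 0` there is `η > 0` such that a
  boundary point within `η` of two distinct arcs is within `ρ` of a marked point common to both;
* `exists_pos_le_dist_pt`, `exists_pos_le_infDist_pt_arc` — distinct corners, and corners off an
  arc, are at positive distance.

Folklore (compactness). Mathlib: `IsCompact.exists_isMinOn`, `Metric.infDist`,
`continuous_infDist_pt`; tree: `MarkedDomain.boundary_not_mem_arc`, `iUnion_arc_holds`,
`isCompact_arc` (`PlanarDomainsTopology.lean`, `PlanarDomains.lean`).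
-/

noncomputable section

open Set Metric Filter Topology

namespace Literature.Probability.RandomPlanarGeometry.MarkedDomain

variable {n : ℕ} (D : MarkedDomain n)

/-- **Two distinct arcs meet only in marked points**: a common point of `arc i` and `arc k`, `k ≠ i`,
is `pt i` or `pt (i + 1)`. [folklore] -/
theorem mem_arc_inter_arc [NeZero n] {i k : Fin n} (hik : k ≠ i) {z : ℂ} (hzi : z ∈ D.arc i) (hzk : z ∈ D.arc k) :
    z = D.pt i ∨ z = D.pt (i + 1) := by
  obtain ⟨s, hs, rfl⟩ := hzi
  rcases hs.1.eq_or_lt with h1 | h1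
  · exact Or.inl (by rw [← h1]; rfl)
  rcases hs.2.lt_or_eq with h2 | h2
  · exact absurd hzk (D.boundary_not_mem_arc hik ⟨h1, h2⟩)
  · exact Or.inr (by rw [h2, D.boundary_nextMark])

/-- **A marked point lies on an arc iff it is one of its endpoints.** [folklore] -/
theorem pt_mem_arc_iff [NeZero n] {m i : Fin n} : D.pt m ∈ D.arc i ↔ m = i ∨ m = i + 1 := by
  constructor
  · intro h
    by_cases hmi : m = i
    · exact Or.inl hmi
    · rcases D.mem_arc_inter_arc hmi h (D.pt_mem_arc_self m) with h' | h'
      · exact Or.inl (D.pt_injective h')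
      · exact Or.inr (D.pt_injective h')
  · rintro (rfl | rfl)
    · exact D.pt_mem_arc_self m
    · exact D.pt_succ_mem_arc i

/-- **Distinct corners are at positive distance** (uniformly). [folklore] -/
theorem exists_pos_le_dist_pt : ∃ c > 0, ∀ m m' : Fin n, m ≠ m' → c ≤ dist (D.pt m) (D.pt m') := by
  classical
  by_cases hn : ∃ p : Fin n × Fin n, p.1 ≠ p.2
  · set P : Finset (Fin n × Fin n) := Finset.univ.filter fun p => p.1 ≠ p.2 with hP
    have hPne : P.Nonempty := by obtain ⟨p, hp⟩ := hn; exact ⟨p, Finset.mem_filter.2 ⟨Finset.mem_univ _, hp⟩⟩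
    refine ⟨P.inf' hPne fun p => dist (D.pt p.1) (D.pt p.2),
      (Finset.lt_inf'_iff hPne).2 fun p hp => dist_pos.2 fun h => (Finset.mem_filter.1 hp).2 (D.pt_injective h),
      fun m m' hmm' => ?_⟩
    exact Finset.inf'_le (fun p : Fin n × Fin n => dist (D.pt p.1) (D.pt p.2)) (Finset.mem_filter.2 ⟨Finset.mem_univ (m, m'), hmm'⟩)
  · refine ⟨1, one_pos, fun m m' hmm' => ?_⟩
    exact absurd ⟨(m, m'), hmm'⟩ hn

/-- **Corners off an arc are at positive distance from it** (uniformly). [folklore] -/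
theorem exists_pos_le_infDist_pt_arc : ∃ c > 0, ∀ (m i : Fin n), D.pt m ∉ D.arc i → c ≤ infDist (D.pt m) (D.arc i) := by
  classical
  set P : Finset (Fin n × Fin n) := Finset.univ.filter fun p => D.pt p.1 ∉ D.arc p.2 with hP
  by_cases hPne : P.Nonempty
  · refine ⟨P.inf' hPne fun p => infDist (D.pt p.1) (D.arc p.2),
      (Finset.lt_inf'_iff hPne).2 fun p hp =>
        ((D.isClosed_arc p.2).notMem_iff_infDist_pos ⟨_, D.pt_mem_arc_self p.2⟩).1 (Finset.mem_filter.1 hp).2,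
      fun m i hmi => ?_⟩
    exact Finset.inf'_le (fun p : Fin n × Fin n => infDist (D.pt p.1) (D.arc p.2)) (Finset.mem_filter.2 ⟨Finset.mem_univ (m, i), hmi⟩)
  · refine ⟨1, one_pos, fun m i hmi => ?_⟩
    exact absurd ⟨(m, i), Finset.mem_filter.2 ⟨Finset.mem_univ _, hmi⟩⟩ hPne

/-- **Corner modulus.** For every `ρ > 0` there is `η > 0` such that every boundary point within
`η` of two distinct arcs is within `ρ` of a marked point lying on both arcs (an endpoint of the
first). [folklore] -/
theorem exists_corner_modulus [NeZero n] {ρ : ℝ} (hρ : 0 < ρ) :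
    ∃ η > 0, ∀ q ∈ frontier D.carrier, ∀ i k : Fin n, k ≠ i → infDist q (D.arc i) < η → infDist q (D.arc k) < η →
      ∃ m : Fin n, (m = i ∨ m = i + 1) ∧ D.pt m ∈ D.arc k ∧ dist q (D.pt m) < ρ := by
  classical
  -- for a fixed pair of arcs
  have key : ∀ p : Fin n × Fin n, ∃ η > 0, p.2 ≠ p.1 → ∀ q ∈ frontier D.carrier,
      infDist q (D.arc p.1) < η → infDist q (D.arc p.2) < η →
        ∃ m : Fin n, (m = p.1 ∨ m = p.1 + 1) ∧ D.pt m ∈ D.arc p.2 ∧ dist q (D.pt m) < ρ := by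
    rintro ⟨i, k⟩
    by_cases hik : k ≠ i
    swap
    · exact ⟨1, one_pos, fun h => absurd h hik⟩
    -- the boundary points far from the common corners
    set T : Set ℂ := {q ∈ frontier D.carrier | ∀ m : Fin n, (m = i ∨ m = i + 1) → D.pt m ∈ D.arc k → ρ ≤ dist q (D.pt m)} with hT
    have hTc : IsCompact T := by
      refine D.toJordanDomain.isCompact_frontier.of_isClosed_subset ?_ (fun q hq => hq.1)
      have e : T = frontier D.carrier ∩ ⋂ m ∈ {m : Fin n | (m = i ∨ m = i + 1) ∧ D.pt m ∈ D.arc k}, {q | ρ ≤ dist q (D.pt m)} := by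
        ext q; simp only [hT, mem_setOf_eq, mem_inter_iff, mem_iInter, and_imp]
      rw [e]
      exact isClosed_frontier.inter (isClosed_biInter fun m _ => isClosed_le continuous_const (continuous_id.dist continuous_const))
    set f : ℂ → ℝ := fun q => max (infDist q (D.arc i)) (infDist q (D.arc k)) with hf
    have hfc : Continuous f := (continuous_infDist_pt _).max (continuous_infDist_pt _)
    have hfpos : ∀ q ∈ T, 0 < f q := by
      intro q hq
      by_contra hle
      push Not at hle
      have h1 : infDist q (D.arc i) = 0 := le_antisymm ((le_max_left _ _).trans hle) infDist_nonneg
      have h2 : infDist q (D.arc k) = 0 := le_antisymm ((le_max_right _ _).trans hle) infDist_nonneg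
      have hqi : q ∈ D.arc i := (D.isClosed_arc i).mem_iff_infDist_zero ⟨_, D.pt_mem_arc_self i⟩ |>.2 h1
      have hqk : q ∈ D.arc k := (D.isClosed_arc k).mem_iff_infDist_zero ⟨_, D.pt_mem_arc_self k⟩ |>.2 h2
      rcases D.mem_arc_inter_arc hik hqi hqk with h | h
      · have := hq.2 i (Or.inl rfl) (h ▸ hqk)
        rw [h, dist_self] at this; linarith
      · have := hq.2 (i + 1) (Or.inr rfl) (h ▸ hqk)
        rw [h, dist_self] at this; linarith
    by_cases hTne : T.Nonempty
    · obtain ⟨q₀, hq₀, hmin⟩ := hTc.exists_isMinOn hTne hfc.continuousOn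
      refine ⟨f q₀, hfpos q₀ hq₀, fun _ q hq h1 h2 => ?_⟩
      by_contra hno
      push Not at hno
      have hqT : q ∈ T := ⟨hq, fun m hm hm' => hno m hm hm'⟩
      have := hmin hqT
      rw [mem_setOf_eq] at this
      exact absurd this (not_le.2 (max_lt h1 h2))
    · refine ⟨1, one_pos, fun _ q hq h1 h2 => ?_⟩
      by_contra hno
      push Not at hno
      exact hTne ⟨q, hq, fun m hm hm' => hno m hm hm'⟩
  choose η hη hηP using key
  have hne : (Finset.univ : Finset (Fin n × Fin n)).Nonempty := ⟨(0, 0), Finset.mem_univ _⟩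
  refine ⟨Finset.univ.inf' hne η, (Finset.lt_inf'_iff hne).2 fun p _ => hη p, fun q hq i k hik h1 h2 => ?_⟩
  have hle : Finset.univ.inf' hne η ≤ η (i, k) := Finset.inf'_le _ (Finset.mem_univ _)
  exact hηP (i, k) hik q hq (h1.trans_le hle) (h2.trans_le hle)

end Literature.Probability.RandomPlanarGeometry.MarkedDomain
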